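import Summits.ValiantsHypothesis.ValiantsHypothesis.Theorems.NcPalindromePower
import HarnessLib

/-!
# Unique-parse-tree (UPT) non-commutative circuits: the structure theorem

Restricted-models rung of the `CommutativityDial` ladder (item `PerNotNcVP` untouched).
MODEL: UPT = normal-form UPT circuits typed by a shape (LLS18 Prop 7); the normal-form
conversion (poly blow-up in print) is NOT formalised (LLS18 = Lagarde–Limaye–Srinivasan 2018).
`P : ArithCircuit R σ` is *typed by the shape `T`* via `ty : ℕ → List Bool` (gate ↦ node of
`T`, a path) when `∀ k < |gates|, GateTyped T ty (ty k) gates[k]` and `OpTyped T ty [] output`: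
sums add operands of their own type, a product gate typed `π` multiplies an operand typed
`π·0` by one typed `π·1`, letters sit at leaves, the only scalar is `0` (`upt_inhabited`).
`typed_hom`: a gate typed by a node `π` is homogeneous of degree `|T_π|`.  STRUCTURE THEOREM
`typed_span` / `output_mem_uptSpan` (LLS18 Lemma 9, first half): for a node `π₀` with ≥ 2
leaves, every gate typed by a prefix of `π₀` — so the output — is an `R`-combination of
framed bodies `h · g · h̄` (`g` a value of a gate typed exactly `π₀`, `h`, `h̄` homogeneous).
The rank bound and the lower bounds follow in `NcUniqueParseTreeRank` / `…Permanent`.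
-/

noncomputable section

namespace Summit.ValiantsHypothesis.ValiantsHypothesis.Theorems.NcUniqueParseTree

set_option linter.dupNamespace false

open Literature.Computability.AlgebraicComplexity
  Literature.Computability.AlgebraicComplexity.ArithCircuit
  Summit.ValiantsHypothesis.ValiantsHypothesis.Theorems.NcAutomatonIntersection
  Summit.ValiantsHypothesis.ValiantsHypothesis.Theorems.NcCentralWidth
  Summit.ValiantsHypothesis.ValiantsHypothesis.Theorems.NcPalindromePower

/-! ## §1 Shapes of parse trees -/

/-- Shapes of binary parse trees. [cite: LagardeLimayeSrinivasan2018, §2] -/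
inductive Shape : Type
  /-- A leaf: one input position. [cite: LagardeLimayeSrinivasan2018, §2] -/
  | leaf : Shape
  /-- An internal node: left and right sub-shapes. [cite: LagardeLimayeSrinivasan2018, §2] -/
  | node : Shape → Shape → Shape

/-- Number of leaves (= degree). [cite: LagardeLimayeSrinivasan2018, §2] -/
def Shape.size : Shape → ℕ
  | .leaf => 1
  | .node l r => l.size + r.size

/-- The sub-shape at a path (`false` = left), `none` off the tree.
[cite: LagardeLimayeSrinivasan2018, §2] -/
def Shape.sub : Shape → List Bool → Option Shape
  | T, [] => some T
  | .leaf, _ :: _ => none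
  | .node l _, false :: π => l.sub π
  | .node _ r, true :: π => r.sub π

/-- Offset of a node: number of leaves to the left of its sub-shape.
[cite: LagardeLimayeSrinivasan2018, §3] -/
def Shape.off : Shape → List Bool → ℕ
  | _, [] => 0
  | .leaf, _ :: _ => 0
  | .node l _, false :: π => l.off π
  | .node l r, true :: π => l.size + r.off π

/-- [cite: LagardeLimayeSrinivasan2018, §2] -/
theorem Shape.sub_nil (T : Shape) : T.sub [] = some T := by cases T <;> rfl

/-- Sub-shapes compose along paths. [cite: LagardeLimayeSrinivasan2018, §2] -/
theorem Shape.sub_sub {T : Shape} {π : List Bool} {S : Shape} (h : T.sub π = some S)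
    (τ : List Bool) : T.sub (π ++ τ) = S.sub τ := by
  induction π generalizing T with
  | nil => rw [Shape.sub_nil, Option.some.injEq] at h; rw [List.nil_append, h]
  | cons c π ih =>
    cases T with
    | leaf => exact absurd h (by simp [Shape.sub])
    | node l r => cases c <;> simp only [Shape.sub, List.cons_append] at h ⊢ <;> exact ih h

/-- The interval below a node fits in `[0, |T|)`. [cite: LagardeLimayeSrinivasan2018, §3] -/
theorem Shape.off_add_size_le {T : Shape} {π : List Bool} {S : Shape} (h : T.sub π = some S) :
    T.off π + S.size ≤ T.size := by
  induction π generalizing T with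
  | nil =>
    rw [Shape.sub_nil, Option.some.injEq] at h; subst h; cases T <;> exact le_of_eq (Nat.zero_add _)
  | cons c π ih =>
    cases T with
    | leaf => exact absurd h (by simp [Shape.sub])
    | node l r =>
      cases c <;> simp only [Shape.sub, Shape.off, Shape.size] at h ⊢ <;> have := ih h <;> omega

/-! ## §2 Typed circuits (UPT normal form) -/

section Typed

variable {R : Type*} [CommSemiring R] {σ : Type*}

/-- An operand *typed `π`*: a reference to a gate of type `π`, a letter at a leaf `π`, or the
scalar `0`. [cite: LagardeLimayeSrinivasan2018, §3 Proposition 7] -/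
inductive OpTyped (T : Shape) (ty : ℕ → List Bool) (π : List Bool) : Operand R σ → Prop
  | gate {j : ℕ} (h : ty j = π) : OpTyped T ty π (.gate j)
  | var {x : σ} (h : T.sub π = some .leaf) : OpTyped T ty π (.var x)
  | zero : OpTyped T ty π (.const 0)

/-- A gate *typed `π`* (UPT normal form): a sum of operands typed `π` (any fan-in), a copy of
an operand typed `π`, or — at an internal node `π` — the product of an operand typed `π·0` by
one typed `π·1`. [cite: LagardeLimayeSrinivasan2018, §3 Proposition 7] -/
inductive GateTyped (T : Shape) (ty : ℕ → List Bool) (π : List Bool) : Gate R σ → Prop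
  | sum {args : List (R × Operand R σ)} (h : ∀ a ∈ args, OpTyped T ty π a.2) :
      GateTyped T ty π (.sum args)
  | copy {u : Operand R σ} (h : OpTyped T ty π u) : GateTyped T ty π (.prod [u])
  | mul {u u' : Operand R σ} {l r : Shape} (hπ : T.sub π = some (.node l r))
      (hu : OpTyped T ty (π ++ [false]) u) (hu' : OpTyped T ty (π ++ [true]) u') :
      GateTyped T ty π (.prod [u, u'])

/-- **Non-vacuity**: the one-gate circuit `X x · X y` of shape `node leaf leaf`, all types the
root `[]`, is in UPT normal form. [cite: LagardeLimayeSrinivasan2018, §3 Proposition 7] -/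
theorem upt_inhabited (x y : σ) :
    (∀ i (hi : i < [Gate.prod [Operand.var (k := R) x, Operand.var y]].length),
      GateTyped (Shape.node .leaf .leaf) (fun _ => []) ((fun _ => []) i)
        [Gate.prod [Operand.var (k := R) x, Operand.var y]][i]) ∧
    OpTyped (Shape.node .leaf .leaf) (fun _ => []) [] (Operand.gate 0 : Operand R σ) := by
  refine ⟨fun i hi => ?_, OpTyped.gate rfl⟩
  obtain rfl : i = 0 := by simpa using hi
  exact GateTyped.mul (Shape.sub_nil _) (OpTyped.var rfl) (OpTyped.var rfl)

/-- Typing of a prefix and of the last gate. [cite: LagardeLimayeSrinivasan2018, §3] -/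
theorem typed_snoc {T : Shape} {ty : ℕ → List Bool} {gs : List (Gate R σ)} {g : Gate R σ}
    (hg : ∀ k (hk : k < (gs ++ [g]).length), GateTyped T ty (ty k) (gs ++ [g])[k]) :
    (∀ k (hk : k < gs.length), GateTyped T ty (ty k) gs[k]) ∧ GateTyped T ty (ty gs.length) g :=
  ⟨fun k hk => by
    have h := hg k (by rw [List.length_append, List.length_singleton]; omega)
    rwa [List.getElem_append_left hk] at h,
   by simpa using hg gs.length (by simp)⟩

/-! ## §3 Typed values are homogeneous of the degree of their type -/

/-- [cite: LagardeLimayeSrinivasan2018, §3 Proposition 7] -/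
theorem opTyped_hom {T : Shape} {ty : ℕ → List Bool} {π : List Bool} {u : Operand R σ}
    (hu : OpTyped T ty π u) (vals : List (FreeAlgebra R σ))
    (hvals : ∀ j, j < vals.length →
      (T.sub (ty j) = none → vals.getD j 0 = 0) ∧
      (∀ S, T.sub (ty j) = some S → degPart T.size S.size (vals.getD j 0) = vals.getD j 0)) :
    (T.sub π = none → u.ncEval vals = 0) ∧
    (∀ S, T.sub π = some S → degPart T.size S.size (u.ncEval vals) = u.ncEval vals) := by
  cases hu with
  | @gate j h =>
    subst h
    by_cases hj : j < vals.length
    · exact hvals j hj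
    · rw [ncEval_gate, List.getD_eq_default _ _ (Nat.le_of_not_lt hj)]
      exact ⟨fun _ => rfl, fun S _ => map_zero _⟩
  | @var x h =>
    refine ⟨fun hn => (by rw [h] at hn; cases hn), fun S hS => ?_⟩
    rw [h, Option.some.injEq] at hS
    subst hS
    have h1 := Shape.off_add_size_le h
    exact degPart_one_ι (by simp only [Shape.size] at h1; omega) x
  | zero =>
    rw [show (Operand.const (0 : R) : Operand R σ).ncEval vals = 0 from map_zero (algebraMap R _)]
    exact ⟨fun _ => rfl, fun S _ => map_zero _⟩

/-- [cite: LagardeLimayeSrinivasan2018, §3 Proposition 7] -/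
theorem gateTyped_hom {T : Shape} {ty : ℕ → List Bool} {π : List Bool} {g : Gate R σ}
    (hg : GateTyped T ty π g) (vals : List (FreeAlgebra R σ))
    (hvals : ∀ j, j < vals.length →
      (T.sub (ty j) = none → vals.getD j 0 = 0) ∧
      (∀ S, T.sub (ty j) = some S → degPart T.size S.size (vals.getD j 0) = vals.getD j 0)) :
    (T.sub π = none → g.ncEval vals = 0) ∧
    (∀ S, T.sub π = some S → degPart T.size S.size (g.ncEval vals) = g.ncEval vals) := by
  cases hg with
  | @sum args h =>
    rw [show Gate.ncEval vals (Gate.sum args) = (args.map fun ca => ca.1 • ca.2.ncEval vals).sum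
      from rfl]
    refine ⟨fun hn => List.sum_eq_zero fun x hx => ?_, fun S hS => ?_⟩
    · obtain ⟨⟨c, o⟩, ho, rfl⟩ := List.mem_map.1 hx
      show c • o.ncEval vals = 0
      rw [(opTyped_hom (u := o) (h (c, o) ho) vals hvals).1 hn, smul_zero]
    · rw [map_list_sum, List.map_map]
      congr 1
      refine List.map_congr_left fun x hx => ?_
      obtain ⟨c, o⟩ := x
      show degPart T.size S.size (c • o.ncEval vals) = c • o.ncEval vals
      rw [map_smul, (opTyped_hom (u := o) (h (c, o) hx) vals hvals).2 S hS]
  | @copy u h =>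
    rw [show Gate.ncEval vals (Gate.prod [u]) = u.ncEval vals by simp [Gate.ncEval]]
    exact opTyped_hom h vals hvals
  | @mul u u' l r hπ hu hu' =>
    rw [show Gate.ncEval vals (Gate.prod [u, u']) = u.ncEval vals * u'.ncEval vals by
      simp [Gate.ncEval]]
    refine ⟨fun hn => (by rw [hπ] at hn; cases hn), fun S hS => ?_⟩
    rw [hπ, Option.some.injEq] at hS
    subst hS
    have hle := Shape.off_add_size_le hπ
    have hl := (opTyped_hom hu vals hvals).2 l (by simp only [Shape.sub_sub hπ, Shape.sub])
    have hr := (opTyped_hom hu' vals hvals).2 r (by simp only [Shape.sub_sub hπ, Shape.sub])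
    simp only [Shape.size] at hle ⊢
    exact degPart_mul_of_eq hl hr (by omega)

/-- **Homogeneity**: in a typed circuit the gate of index `j` computes `0` if `ty j` is not a
node of `T`, and a homogeneous polynomial of degree `|T_{ty j}|` otherwise.
[cite: LagardeLimayeSrinivasan2018, §3 Proposition 7] -/
theorem typed_hom {T : Shape} {ty : ℕ → List Bool} (gs : List (Gate R σ))
    (hg : ∀ k (hk : k < gs.length), GateTyped T ty (ty k) gs[k]) :
    ∀ j, j < gs.length →
      (T.sub (ty j) = none → (ncGateValues gs).getD j 0 = 0) ∧
      (∀ S, T.sub (ty j) = some S →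
        degPart T.size S.size ((ncGateValues gs).getD j 0) = (ncGateValues gs).getD j 0) := by
  induction gs using List.reverseRecOn with
  | nil => intro j hj; exact absurd hj (Nat.not_lt_zero j)
  | append_singleton gs g ih =>
    obtain ⟨hg', hlast⟩ := typed_snoc hg
    have hlen : (ncGateValues gs).length = gs.length := by
      simpa using (ncGateValues_append_getD gs []).1
    intro j hj
    rw [List.length_append, List.length_singleton] at hj
    rcases Nat.lt_or_ge j gs.length with hj' | hj'
    · rw [(ncGateValues_append_getD gs [g]).2 j hj']
      exact ih hg' j hj'
    · obtain rfl : j = gs.length := by omega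
      rw [ncGateValues_getD_length]
      exact gateTyped_hom hlast (ncGateValues gs) fun i hi => ih hg' i (by omega)

/-! ## §4 The UPT span of a node type -/

/-- Bodies of type `π₀` = values of gates typed `π₀`. [cite: LagardeLimayeSrinivasan2018, §3] -/
def tyBodies (gs : List (Gate R σ)) (ty : ℕ → List Bool) (π₀ : List Bool) :
    Set (FreeAlgebra R σ) :=
  {g | ∃ j, j < gs.length ∧ ty j = π₀ ∧ g = (ncGateValues gs).getD j 0}

/-- The `R`-span of the framed bodies `h · g · h̄`, `g ∈ B`, `h`, `h̄` homogeneous of degrees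
`a`, `b` (read by `degPart d`). [cite: LagardeLimayeSrinivasan2018, §3 Lemma 9] -/
def uptSpan (B : Set (FreeAlgebra R σ)) (d a b : ℕ) : Submodule R (FreeAlgebra R σ) :=
  Submodule.span R {x | ∃ g h hb : FreeAlgebra R σ, g ∈ B ∧ degPart d a h = h ∧
    degPart d b hb = hb ∧ x = h * g * hb}

/-- Frames absorb homogeneous factors. [cite: LagardeLimayeSrinivasan2018, §3 Lemma 9] -/
theorem frame_mem_uptSpan {B : Set (FreeAlgebra R σ)} {d a b c c' : ℕ}
    {x q q' : FreeAlgebra R σ} (hx : x ∈ uptSpan B d a b) (hq : degPart d c q = q)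
    (hq' : degPart d c' q' = q') (hca : c + a ≤ d) (hbc : b + c' ≤ d) :
    q * x * q' ∈ uptSpan B d (c + a) (b + c') := by
  unfold uptSpan at hx
  induction hx using Submodule.span_induction with
  | mem x hx' =>
    obtain ⟨g, h, hb, hg, hh, hhb, rfl⟩ := hx'
    exact Submodule.subset_span ⟨g, q * h, hb * q', hg, degPart_mul_of_eq hq hh hca,
      degPart_mul_of_eq hhb hq' hbc, by simp only [mul_assoc]⟩
  | zero => rw [mul_zero, zero_mul]; exact zero_mem _
  | add x y _ _ hx hy => rw [mul_add, add_mul]; exact add_mem hx hy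
  | smul t x _ hx => rw [mul_smul_comm, smul_mul_assoc]; exact Submodule.smul_mem _ t hx

/-! ## §5 The structure theorem: values of prefix types are framed bodies -/

/-- Operand step of the structure theorem (generic body set `B` and value list).
[cite: LagardeLimayeSrinivasan2018, §3 Lemma 9] -/
theorem opTyped_span {T : Shape} {ty : ℕ → List Bool} {π₀ : List Bool} {S₀ : Shape}
    (hS₀ : T.sub π₀ = some S₀) (h2 : 2 ≤ S₀.size) (B : Set (FreeAlgebra R σ))
    (vals : List (FreeAlgebra R σ))
    (hW : ∀ j, j < vals.length → ∀ (τ : List Bool) (S : Shape), π₀ = ty j ++ τ →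
      T.sub (ty j) = some S →
        vals.getD j 0 ∈ uptSpan B T.size (S.off τ) (S.size - (S.off τ + S₀.size)))
    {π : List Bool} {u : Operand R σ} (hu : OpTyped T ty π u) (τ : List Bool) (S : Shape)
    (hπ : π₀ = π ++ τ) (hS : T.sub π = some S) :
    u.ncEval vals ∈ uptSpan B T.size (S.off τ) (S.size - (S.off τ + S₀.size)) := by
  cases hu with
  | @gate j h =>
    subst h
    by_cases hj : j < vals.length
    · exact hW j hj τ S hπ hS
    · rw [ncEval_gate, List.getD_eq_default _ _ (Nat.le_of_not_lt hj)]; exact zero_mem _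
  | @var x h =>
    exfalso
    have h' := Shape.sub_sub h τ
    rw [← hπ, hS₀] at h'
    cases τ with
    | nil =>
      rw [Shape.sub_nil, Option.some.injEq] at h'; subst h'; exact absurd h2 (by show ¬2 ≤ 1; omega)
    | cons c τ => exact absurd h' (by simp [Shape.sub])
  | zero =>
    rw [show (Operand.const (0 : R) : Operand R σ).ncEval vals = 0 from map_zero (algebraMap R _)]
    exact zero_mem _

/-- Gate step of the structure theorem. [cite: LagardeLimayeSrinivasan2018, §3 Lemma 9] -/
theorem gateTyped_span {T : Shape} {ty : ℕ → List Bool} {π₀ : List Bool} {S₀ : Shape}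
    (hS₀ : T.sub π₀ = some S₀) (h2 : 2 ≤ S₀.size) (B : Set (FreeAlgebra R σ))
    (vals : List (FreeAlgebra R σ))
    (hH : ∀ j, j < vals.length →
      (T.sub (ty j) = none → vals.getD j 0 = 0) ∧
      (∀ S, T.sub (ty j) = some S → degPart T.size S.size (vals.getD j 0) = vals.getD j 0))
    (hW : ∀ j, j < vals.length → ∀ (τ : List Bool) (S : Shape), π₀ = ty j ++ τ →
      T.sub (ty j) = some S →
        vals.getD j 0 ∈ uptSpan B T.size (S.off τ) (S.size - (S.off τ + S₀.size)))
    {π : List Bool} {g : Gate R σ} (hg : GateTyped T ty π g) (hself : π = π₀ → g.ncEval vals ∈ B)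
    (τ : List Bool) (S : Shape) (hπ : π₀ = π ++ τ) (hS : T.sub π = some S) :
    g.ncEval vals ∈ uptSpan B T.size (S.off τ) (S.size - (S.off τ + S₀.size)) := by
  cases τ with
  | nil =>
    rw [List.append_nil] at hπ; subst hπ
    rw [hS, Option.some.injEq] at hS₀; subst hS₀
    rw [show S.off [] = 0 from by cases S <;> rfl, show S.size - (0 + S.size) = 0 by omega]
    exact Submodule.subset_span
      ⟨_, 1, 1, hself rfl, degPart_zero_one _, degPart_zero_one _, by rw [one_mul, mul_one]⟩
  | cons c τ =>
    cases hg with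
    | @sum args h =>
      rw [show Gate.ncEval vals (Gate.sum args) = (args.map fun ca => ca.1 • ca.2.ncEval vals).sum
        from rfl]
      refine list_sum_mem fun x hx => ?_
      obtain ⟨⟨c', o⟩, ho, rfl⟩ := List.mem_map.1 hx
      exact Submodule.smul_mem _ c'
        (opTyped_span hS₀ h2 B vals hW (u := o) (h (c', o) ho) (c :: τ) S hπ hS)
    | @copy u h =>
      rw [show Gate.ncEval vals (Gate.prod [u]) = u.ncEval vals by simp [Gate.ncEval]]
      exact opTyped_span hS₀ h2 B vals hW h (c :: τ) S hπ hS
    | @mul u u' l r hπ' hu hu' =>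
      rw [show Gate.ncEval vals (Gate.prod [u, u']) = u.ncEval vals * u'.ncEval vals by
        simp [Gate.ncEval]]
      rw [hπ', Option.some.injEq] at hS; subst hS
      have hl : T.sub (π ++ [false]) = some l := by simp only [Shape.sub_sub hπ', Shape.sub]
      have hr : T.sub (π ++ [true]) = some r := by simp only [Shape.sub_sub hπ', Shape.sub]
      have hle := Shape.off_add_size_le hπ'
      cases c with
      | false =>
        have hπ2 : π₀ = π ++ [false] ++ τ := by rw [hπ, List.append_assoc, List.singleton_append]
        have hle0 := Shape.off_add_size_le (show l.sub τ = some S₀ by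
          rw [← Shape.sub_sub hl, ← hπ2, hS₀])
        simp only [Shape.size, Shape.off] at hle ⊢
        have key := frame_mem_uptSpan (opTyped_span hS₀ h2 B vals hW hu τ l hπ2 hl)
          (degPart_zero_one _) ((opTyped_hom hu' vals hH).2 r hr) (by omega) (by omega)
        rw [one_mul, Nat.zero_add, show l.size - (l.off τ + S₀.size) + r.size =
          l.size + r.size - (l.off τ + S₀.size) by omega] at key
        exact key
      | true =>
        have hπ2 : π₀ = π ++ [true] ++ τ := by rw [hπ, List.append_assoc, List.singleton_append]
        have hle0 := Shape.off_add_size_le (show r.sub τ = some S₀ by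
          rw [← Shape.sub_sub hr, ← hπ2, hS₀])
        simp only [Shape.size, Shape.off] at hle ⊢
        have key := frame_mem_uptSpan (opTyped_span hS₀ h2 B vals hW hu' τ r hπ2 hr)
          ((opTyped_hom hu vals hH).2 l hl) (degPart_zero_one _) (by omega) (by omega)
        rw [mul_one, Nat.add_zero, show r.size - (r.off τ + S₀.size) =
          l.size + r.size - (l.size + r.off τ + S₀.size) by omega] at key
        exact key

/-- **Structure theorem**: for every node `π₀` of `T` with at least two leaves, the value of a
gate whose type `π` is a prefix of `π₀ = π ++ τ` lies in the span of `h · g · h̄`, `g` a value of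
a gate typed exactly `π₀`, `h` homogeneous of degree `off_{T_π} τ`, `h̄` of the complementary
degree inside `T_π`. [cite: LagardeLimayeSrinivasan2018, §3 Lemma 9] -/
theorem typed_span {T : Shape} {ty : ℕ → List Bool} {π₀ : List Bool} {S₀ : Shape}
    (hS₀ : T.sub π₀ = some S₀) (h2 : 2 ≤ S₀.size) (gs : List (Gate R σ))
    (hg : ∀ k (hk : k < gs.length), GateTyped T ty (ty k) gs[k]) :
    ∀ j, j < gs.length → ∀ (τ : List Bool) (S : Shape), π₀ = ty j ++ τ → T.sub (ty j) = some S →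
      (ncGateValues gs).getD j 0 ∈
        uptSpan (tyBodies gs ty π₀) T.size (S.off τ) (S.size - (S.off τ + S₀.size)) := by
  induction gs using List.reverseRecOn with
  | nil => intro j hj; exact absurd hj (Nat.not_lt_zero j)
  | append_singleton gs g ih =>
    obtain ⟨hg', hlast⟩ := typed_snoc hg
    have hlen : (ncGateValues gs).length = gs.length := by
      simpa using (ncGateValues_append_getD gs []).1
    have hmono : ∀ a b, uptSpan (tyBodies gs ty π₀) T.size a b ≤
        uptSpan (tyBodies (gs ++ [g]) ty π₀) T.size a b := fun a b =>
      Submodule.span_mono fun _ ⟨x, h, hb, ⟨i, hi, hty, hx'⟩, hh, hhb, hx⟩ =>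
        ⟨x, h, hb, ⟨i, by rw [List.length_append, List.length_singleton]; omega, hty,
          by rw [hx', (ncGateValues_append_getD gs [g]).2 i hi]⟩, hh, hhb, hx⟩
    intro j hj τ S hπ hS
    rw [List.length_append, List.length_singleton] at hj
    rcases Nat.lt_or_ge j gs.length with hj' | hj'
    · rw [(ncGateValues_append_getD gs [g]).2 j hj']
      exact hmono _ _ (ih hg' j hj' τ S hπ hS)
    · obtain rfl : j = gs.length := by omega
      rw [ncGateValues_getD_length]
      exact gateTyped_span hS₀ h2 (tyBodies (gs ++ [g]) ty π₀) (ncGateValues gs)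
        (fun i hi => typed_hom gs hg' i (by omega))
        (fun i hi τ' S' hπ' hS' => hmono _ _ (ih hg' i (by omega) τ' S' hπ' hS')) hlast
        (fun hty => ⟨gs.length, by rw [List.length_append, List.length_singleton]; omega, hty,
          (ncGateValues_getD_length gs g).symm⟩) τ S hπ hS

/-- **UPT STRUCTURE THEOREM at the output** (UPT = normal-form UPT circuits typed by a shape
(LLS18 Prop 7); the normal-form conversion (poly blow-up in print) is NOT formalised): for every
node `π₀` of `T` with at least two leaves, the output of a typed circuit of shape `T` is an
`R`-combination of `h · g · h̄` with `g` a value of a gate typed `π₀`, `h` homogeneous of degree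
`off π₀` and `h̄` of degree `|T| - off π₀ - |T_{π₀}|`.
[cite: LagardeLimayeSrinivasan2018, §3 Lemma 9] [cite: LagardeMalodPerifel2019, §3] -/
theorem output_mem_uptSpan (P : ArithCircuit R σ) {T : Shape} {ty : ℕ → List Bool}
    (hg : ∀ k (hk : k < P.gates.length), GateTyped T ty (ty k) P.gates[k])
    (ho : OpTyped T ty [] P.output) {π₀ : List Bool} {S₀ : Shape} (hS₀ : T.sub π₀ = some S₀)
    (h2 : 2 ≤ S₀.size) :
    P.ncEval ∈ uptSpan (tyBodies P.gates ty π₀) T.size (T.off π₀)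
      (T.size - (T.off π₀ + S₀.size)) := by
  have hlen : (ncGateValues P.gates).length = P.gates.length := by
    simpa using (ncGateValues_append_getD P.gates []).1
  exact opTyped_span hS₀ h2 (tyBodies P.gates ty π₀) (ncGateValues P.gates)
    (fun j hj τ S hπ hS => typed_span hS₀ h2 P.gates hg j (by omega) τ S hπ hS) ho π₀ T
    (List.nil_append π₀).symm (Shape.sub_nil T)

end Typed

end Summit.ValiantsHypothesis.ValiantsHypothesis.Theorems.NcUniqueParseTree

end
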